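/-
Copyright: the b2b-balaban T⁴-continuum CRUX team, row NE7b OWNER lineage `t4-ne7b-p1` (gen 128). Project licence.
-/
import Summits.QuantumFields.BalabanUV.T4Continuum.Spine.NE7b.SupRegulatorFlow

/-!
# SUMMABLE MARGINS: THE REGULATOR FLOW LOSES ONLY CONSTANTS.  Along (301)'s flow with margins `θ_j ≤ ½` and `Σ_{j<n}θ_j ≤ S`, the growth of
# the regulator is `c_n = Π_{j<n}(1−θ_j)⁻¹ ≤ e^{2S}` and the accumulated prefactor is `Π_{j<n}(1−θ_j)^{−c_j tr(MΓ_j)∕(2θ_j)} ≤ e^{e^{2S}·tr(M·Σ_{j<n}Γ_j)}`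
# — controlled by the trace of the regulator against the TOTAL covariance `Σ_jΓ_j`, exactly as for a single Gaussian step: so after any
# number of scales `‖K_n(φ)‖ ≤ A·e^{e^{2S}tr(MΣ_{j<n}Γ_j)}·e^{½e^{2S}φᵀMφ}` (row NE7b, node U5c; (301) + real analysis `(1−θ)⁻¹ ≤ e^{2θ}`,
# `(1−θ)^{−t∕(2θ)} ≤ e^t` for `θ ≤ ½`; [folklore])

Cell `pub-balaban`, sub-cell `t4`, spine estimate NE7b (`T4WeightBudget.RelWeightBound`; the cell's OWN estimate — NOT PRINTED in
[Bałaban 1983–89], NOT PROVED).  Crux-route work under `Spine/NE7b/` by the row OWNER (`t4-ne7b-p1` gen 128, file (302)) under FREEZE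
(0)'s crux-prover clause, on § [NE7bP1-G127-HANDOFF] NEXT (3)(b)∕(e) (towards the iteration); NOTHING of Bałaban's is named as a Lean object,
valued or asserted; no `T4Continuum/Support` leaf typed; no `def`, no notation; zero `sorry`.  Imports (BY NAME): the OWNER's (301)
`…SupRegulatorFlow` (`regulator_flow`), (288) (`sqrt_conj_posSemidef`, `trace_sqrt_conj` — for `tr(MΓ) ≥ 0`); Mathlib's `Real.add_one_le_exp`,
`Real.exp_sum`, `Finset.prod_le_prod`, `Matrix.trace_sum`, `Finset.mul_sum`.

WHY (located).  (301) iterates (295) with per-step losses `(1−θ_j)⁻¹` on the regulator strength and `(1−θ_j)^{−c_j tr(MΓ_j)∕(2θ_j)}` on the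
prefactor; along (280)'s scales the margins can be chosen geometric (`θ_j ∝ κ·K_j`, `K_j = O(4^{−j})` by (284)), hence summable.  This file
shows that summable margins cost only CONSTANTS, uniformly in the number of scales, and that the accumulated determinant prefactor is the
regulator's trace against the total covariance — the multiscale flow is no worse than one Gaussian step with covariance `ΣΓ_j`.

WHAT IS PROVED ([folklore]):
* §1 real analysis for `0 ≤ θ ≤ ½`: `inv_one_sub_le_exp` (`(1−θ)⁻¹ ≤ e^{2θ}`), `neg_log_one_sub_le` (`−log(1−θ) ≤ 2θ`),
  `rpow_neg_div_le_exp` (`(1−θ)^{−t∕(2θ)} ≤ e^t` for `t ≥ 0`, `θ > 0`), `prod_inv_one_sub_le_exp` (`Π_{j<n}(1−θ_j)⁻¹ ≤ e^{2Σ_{j<n}θ_j}`);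
* §2 `trace_mul_nonneg` (`0 ⪯ M, Γ` ⟹ `0 ≤ tr(MΓ)`), `trace_mul_sum` (`Σ_{j<n}tr(MΓ_j) = tr(M·Σ_{j<n}Γ_j)`), `prefactor_prod_le_exp`
  (`Π_{j<n}(1−θ_j)^{−c_j tr(MΓ_j)∕(2θ_j)} ≤ e^{e^{2S}tr(MΣ_{j<n}Γ_j)}` when `c_j ≤ e^{2S}`);
* §3 THE END **`regulator_flow_summable`** (under (301)'s hypotheses with `θ_j ≤ ½` and `Σ_{j<n}θ_j ≤ S` for all `n`:
  `‖K_n(φ)‖ ≤ A·e^{e^{2S}·tr(M·Σ_{j<n}Γ_j)}·e^{½e^{2S}·φᵀMφ}` for every `n, φ`); §4 toy.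

HONEST (what this is NOT).  Real analysis on (301)'s abstract flow; the choice of the margins for the road's scales (`θ_j = κK_j e^{2S}`-type,
consistent with the grown subcriticality) is arithmetic left to the consumer; scalar skeleton ((A3), NC-NE7b-α UNRULED); nothing of Bałaban's
asserted.  BY-NAME EFFECT ON THE WALL: NONE.  NE7b NOT PRINTED ∕ NOT PROVED; spine PROVED 0∕9; rung (B)+1 — the programme's measures remain
FINITE-torus statements; NOT the mass gap, NOT Clay.  HONEST DEPENDENCY: continuum YM on T⁴ ⇐ BetaPertH ∧ nine spine estimates (0∕9 proved);
BetaPertH ⇐ (D1) ∧ (D4) ∧ CAP+tail; G-an2-4 gates asym, D1 and NE2∕3∕4.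
-/

set_option autoImplicit false

noncomputable section

namespace Summit.QuantumFields.BalabanUV.T4Continuum.NE7b.SupRegulatorFlowSummable

open MeasureTheory ProbabilityTheory Matrix Real WithLp Finset
open scoped BigOperators
open SupGaussianRegulator (sqrt_conj_posSemidef trace_sqrt_conj)
open SupRegulatorFlow (regulator_flow)

variable {ι : Type*} [Fintype ι] [DecidableEq ι]

/-! ## §1. Real analysis of small margins -/

/-- `(1−θ)⁻¹ ≤ e^{2θ}` for `0 ≤ θ ≤ ½` (`(1−θ)(1+2θ) ≥ 1` and `1 + 2θ ≤ e^{2θ}`). [folklore] -/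
theorem inv_one_sub_le_exp {θ : ℝ} (h0 : 0 ≤ θ) (h1 : θ ≤ 1 / 2) : (1 - θ)⁻¹ ≤ exp (2 * θ) := by
  have hpos : 0 < 1 - θ := by linarith
  rw [inv_le_iff_one_le_mul₀' hpos]
  have h2 : 1 + 2 * θ ≤ exp (2 * θ) := by linarith [add_one_le_exp (2 * θ)]
  nlinarith [h2, exp_pos (2 * θ)]

/-- `−log(1−θ) ≤ 2θ` for `0 ≤ θ ≤ ½`. [folklore] -/
theorem neg_log_one_sub_le {θ : ℝ} (h0 : 0 ≤ θ) (h1 : θ ≤ 1 / 2) : -log (1 - θ) ≤ 2 * θ := by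
  have hpos : 0 < 1 - θ := by linarith
  rw [← log_inv, ← log_exp (2 * θ)]
  exact log_le_log (inv_pos.2 hpos) (inv_one_sub_le_exp h0 h1)

/-- **ONE STEP'S PREFACTOR COSTS `e^t`**: `(1−θ)^{−t∕(2θ)} ≤ e^t` for `0 < θ ≤ ½`, `t ≥ 0`. [folklore] -/
theorem rpow_neg_div_le_exp {θ t : ℝ} (h0 : 0 < θ) (h1 : θ ≤ 1 / 2) (ht : 0 ≤ t) : (1 - θ) ^ (-(t / (2 * θ))) ≤ exp t := by
  have hpos : 0 < 1 - θ := by linarith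
  rw [rpow_def_of_pos hpos]
  refine exp_le_exp.2 ?_
  have hl := neg_log_one_sub_le h0.le h1
  have hkey : log (1 - θ) * -(t / (2 * θ)) = (t / (2 * θ)) * (-log (1 - θ)) := by ring
  rw [hkey]
  calc t / (2 * θ) * -log (1 - θ) ≤ t / (2 * θ) * (2 * θ) := mul_le_mul_of_nonneg_left hl (by positivity)
    _ = t := by field_simp

/-- **THE GROWTH IS BOUNDED BY THE SUM OF THE MARGINS**: `0 ≤ θ_j ≤ ½` ⟹ `Π_{j<n}(1−θ_j)⁻¹ ≤ e^{2Σ_{j<n}θ_j}`. [folklore] -/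
theorem prod_inv_one_sub_le_exp (θ : ℕ → ℝ) (h0 : ∀ j, 0 ≤ θ j) (h1 : ∀ j, θ j ≤ 1 / 2) (n : ℕ) :
    ∏ j ∈ range n, (1 - θ j)⁻¹ ≤ exp (2 * ∑ j ∈ range n, θ j) := by
  rw [mul_sum, Real.exp_sum]
  exact prod_le_prod (fun j _ => inv_nonneg.2 (by linarith [h1 j])) fun j _ => inv_one_sub_le_exp (h0 j) (h1 j)

/-! ## §2. Traces along the flow -/

/-- `0 ⪯ M, Γ` ⟹ `0 ≤ tr(MΓ)` (`= tr(√ΓM√Γ)`, a positive semidefinite matrix). [folklore] -/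
theorem trace_mul_nonneg {M Γ : Matrix ι ι ℝ} (hM : M.PosSemidef) (hΓ : Γ.PosSemidef) : 0 ≤ (M * Γ).trace := by
  rw [← trace_sqrt_conj hΓ M]
  exact (sqrt_conj_posSemidef Γ hM).trace_nonneg

omit [DecidableEq ι] in
/-- `Σ_{j<n}tr(MΓ_j) = tr(M·Σ_{j<n}Γ_j)`. [folklore] -/
theorem trace_mul_sum (M : Matrix ι ι ℝ) (Γ : ℕ → Matrix ι ι ℝ) (n : ℕ) :
    ∑ j ∈ range n, (M * Γ j).trace = (M * ∑ j ∈ range n, Γ j).trace := by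
  rw [Matrix.mul_sum, trace_sum]

/-- **THE ACCUMULATED PREFACTOR IS THE TRACE AGAINST THE TOTAL COVARIANCE**: `0 < θ_j ≤ ½`, `0 ≤ c_j ≤ C`, `0 ≤ t_j` ⟹
`Π_{j<n}(1−θ_j)^{−c_jt_j∕(2θ_j)} ≤ e^{C·Σ_{j<n}t_j}`. [folklore] -/
theorem prefactor_prod_le_exp (θ c t : ℕ → ℝ) {C : ℝ} (hθ0 : ∀ j, 0 < θ j) (hθ1 : ∀ j, θ j ≤ 1 / 2) (hc0 : ∀ j, 0 ≤ c j)
    (hcC : ∀ j, c j ≤ C) (ht : ∀ j, 0 ≤ t j) (n : ℕ) :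
    ∏ j ∈ range n, (1 - θ j) ^ (-((c j * t j) / (2 * θ j))) ≤ exp (C * ∑ j ∈ range n, t j) := by
  rw [mul_sum, Real.exp_sum]
  refine prod_le_prod (fun j _ => rpow_nonneg (by linarith [hθ1 j]) _) fun j _ => ?_
  calc (1 - θ j) ^ (-((c j * t j) / (2 * θ j))) ≤ exp (c j * t j) := rpow_neg_div_le_exp (hθ0 j) (hθ1 j) (mul_nonneg (hc0 j) (ht j))
    _ ≤ exp (C * t j) := exp_le_exp.2 (mul_le_mul_of_nonneg_right (hcC j) (ht j))

/-! ## §3. THE END: the flow with summable margins -/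

/-- **THE REGULATOR FLOW WITH SUMMABLE MARGINS LOSES ONLY CONSTANTS.**  Under (301)'s hypotheses (`Γ_j ⪰ 0`, `Γ_j ⪯ γ_j·1`, `γ_j ≥ 0`;
`0 ⪯ M ⪯ κ·1`, `κ ≥ 0`; `0 < θ_j < 1` with the grown subcriticality `(Π_{i<j}(1−θ_i)⁻¹)κγ_j ≤ θ_j`; `‖K_0(x)‖ ≤ Ae^{½xᵀMx}`, `A ≥ 0`;
`K_{j+1}(φ) = ∫K_j(x+φ)dN(0,Γ_j)`) and moreover `θ_j ≤ ½` with `Σ_{j<n}θ_j ≤ S` for every `n`: for every `n` and `φ`,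
`‖K_n(φ)‖ ≤ A·e^{e^{2S}·tr(M·Σ_{j<n}Γ_j)}·e^{½e^{2S}φᵀMφ}`. [folklore] -/
theorem regulator_flow_summable {E : Type*} [NormedAddCommGroup E] [NormedSpace ℝ E] (Γ : ℕ → Matrix ι ι ℝ) (γ θ : ℕ → ℝ)
    {M : Matrix ι ι ℝ} {κ A S : ℝ} (hΓ : ∀ j, (Γ j).PosSemidef) (hΓop : ∀ j, (γ j • (1 : Matrix ι ι ℝ) - Γ j).PosSemidef)
    (hγ : ∀ j, 0 ≤ γ j) (hM : M.PosSemidef) (hMκ : (κ • (1 : Matrix ι ι ℝ) - M).PosSemidef) (hκ : 0 ≤ κ) (hθ0 : ∀ j, 0 < θ j)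
    (hθhalf : ∀ j, θ j ≤ 1 / 2) (hS : ∀ n, ∑ j ∈ range n, θ j ≤ S) (hA : 0 ≤ A)
    (hsub : ∀ j, (∏ i ∈ range j, (1 - θ i)⁻¹) * κ * γ j ≤ θ j) (K : ℕ → (ι → ℝ) → E)
    (hK0 : ∀ x, ‖K 0 x‖ ≤ A * exp ((x ⬝ᵥ M *ᵥ x) / 2))
    (hstep : ∀ j φ, K (j + 1) φ = ∫ x, K j (ofLp x + φ) ∂(multivariateGaussian 0 (Γ j))) (n : ℕ) (φ : ι → ℝ) :
    ‖K n φ‖ ≤ A * exp (exp (2 * S) * (M * ∑ j ∈ range n, Γ j).trace) * exp (exp (2 * S) * (φ ⬝ᵥ M *ᵥ φ) / 2) := by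
  have hθ1 : ∀ j, θ j < 1 := fun j => by linarith [hθhalf j]
  have h := regulator_flow Γ γ θ hΓ hΓop hγ hM hMκ hκ hθ0 hθ1 hA hsub K hK0 hstep n φ
  refine h.trans ?_
  -- the growth factors are `≤ e^{2S}`
  have hcle : ∀ m, ∏ i ∈ range m, (1 - θ i)⁻¹ ≤ exp (2 * S) := fun m =>
    (prod_inv_one_sub_le_exp θ (fun j => (hθ0 j).le) hθhalf m).trans (exp_le_exp.2 (by linarith [hS m]))
  have hc0 : ∀ m, 0 ≤ ∏ i ∈ range m, (1 - θ i)⁻¹ := fun m => prod_nonneg fun i _ => inv_nonneg.2 (by linarith [hθ1 i])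
  -- the prefactor
  have hpre : ∏ j ∈ range n, (1 - θ j) ^ (-(((∏ i ∈ range j, (1 - θ i)⁻¹) * (M * Γ j).trace) / (2 * θ j))) ≤
      exp (exp (2 * S) * (M * ∑ j ∈ range n, Γ j).trace) := by
    rw [← trace_mul_sum]
    exact prefactor_prod_le_exp θ (fun j => ∏ i ∈ range j, (1 - θ i)⁻¹) (fun j => (M * Γ j).trace) hθ0 hθhalf hc0 hcle
      (fun j => trace_mul_nonneg hM (hΓ j)) n
  -- the regulator
  have hq : 0 ≤ φ ⬝ᵥ M *ᵥ φ := by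
    have := hM.dotProduct_mulVec_nonneg φ
    rwa [star_trivial] at this
  have hreg : exp (((∏ j ∈ range n, (1 - θ j)⁻¹) * (φ ⬝ᵥ M *ᵥ φ)) / 2) ≤ exp (exp (2 * S) * (φ ⬝ᵥ M *ᵥ φ) / 2) :=
    exp_le_exp.2 (by nlinarith [mul_le_mul_of_nonneg_right (hcle n) hq])
  calc (A * ∏ j ∈ range n, (1 - θ j) ^ (-(((∏ i ∈ range j, (1 - θ i)⁻¹) * (M * Γ j).trace) / (2 * θ j)))) *
        exp (((∏ j ∈ range n, (1 - θ j)⁻¹) * (φ ⬝ᵥ M *ᵥ φ)) / 2)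
      ≤ (A * exp (exp (2 * S) * (M * ∑ j ∈ range n, Γ j).trace)) * exp (exp (2 * S) * (φ ⬝ᵥ M *ᵥ φ) / 2) :=
        mul_le_mul (mul_le_mul_of_nonneg_left hpre hA) hreg (exp_pos _).le (mul_nonneg hA (exp_pos _).le)
    _ = _ := by ring

/-! ## §4. Toy -/

/-- Toy (§1): with `θ = ½`, `(1 − ½)⁻¹ = 2 ≤ e`. -/
example : (1 - (1 / 2 : ℝ))⁻¹ ≤ exp (2 * (1 / 2 : ℝ)) := inv_one_sub_le_exp (by norm_num) le_rfl

end Summit.QuantumFields.BalabanUV.T4Continuum.NE7b.SupRegulatorFlowSummable
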